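import Literature.NumberTheory.Automorphic.LanglandsTetrahedral
import Literature.NumberTheory.Automorphic.PairLFunctionBaseChange
import Literature.NumberTheory.GaloisRepresentations.HeckeCharacter
import HarnessLib

/-!
# Ramakrishnan's automorphic tensor product `π ⊠ π' : GL(2) × GL(2) → GL(4)` — cuspidal case
(named fact)

Family `lang`, layer `Literature/NumberTheory/Automorphic`. Consumer: the route
`Summits/Langlands/Langlands/Theses/TrigonalHeart`, crux `TwistedTensorResidualAutomorphy`
("Ramakrishnan cuspidality needs `ρ_{g₁} ⊗ ρ_{g₂}` irreducible"). Source read, verbatim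
(D. Ramakrishnan, *Modularity of the Rankin–Selberg `L`-series, and multiplicity one for `SL(2)`*,
Ann. of Math. 152 (2000) 45–111, §3, p. 9 of the paper, held as `paper:galaxy-pdf-4279542020`;
`𝒜(n, F)` = isobaric automorphic representations of `GL(n, 𝔸_F)`, §2.2):

"**Theorem M** Let `π`, `π'` be in `𝒜(2, F)`. Then we have: **Existence**: There exists an
isobaric automorphic representation `π ⊠ π'` of `GL(4, 𝔸_F)` satisfying (at every finite place
`v`) `L(s, (π ⊠ π')_v) = L(s, π_v × π'_v)`, and `ε(s, (π ⊠ π')_v) = ε(s, π_v × π'_v)`. We also have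
`L(s, (π ⊠ π')_∞) = L(s, π_∞ × π'_∞)`. **Cuspidality Criterion**: Suppose `π, π'` are both
cuspidal. If neither of them is associated to a character of a quadratic extension, then `π ⊠ π'`
is cuspidal iff we have (C) `π'` is not equivalent to `π ⊗ χ`, for any idele class character `χ`
of `F`. If `π' = I_K^F(μ)`, for a character `μ` of a quadratic extension `K`, then `π ⊠ π'` is
cuspidal iff the base change `π_K` is cuspidal and not isomorphic to `π_K ⊗ (μ ∘ θ)μ⁻¹`, where `θ`
denotes the non-trivial automorphism of `K/F`." (Restated verbatim as Thm. 3.2 of D. Ramakrishnan, S. Wang, *On the exceptional zeros of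
Rankin–Selberg `L`-functions*, Compositio Math. 135 (2003), arXiv:math/0108054 p. 9.) And §2.2, (2.2.6): "When `v` is archimedean or a finite place outside
`ram(π)`, one has `L_v(s, π × π') = L(s, σ(π_v) ⊗ σ(π'_v))`" — so at a finite place where `π_v`,
`π'_v` are unramified with Satake parameters `{αᵢ}`, `{βⱼ}`, `(π ⊠ π')_v` is the unramified
representation with Satake parameter `{αᵢ βⱼ}`.

## The statement in the tree's adelic language (unramified shadows, as for
`GelbartJacquet_adjoint_lift`)

* `satakeTensor α β = {a b | a ∈ α, b ∈ β}` (the tree's definition, `PairLFunctionBaseChange`) —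
  the Satake parameter of the local functorial tensor product (`(2.2.6)`).
* "`π` is not associated to a character of a quadratic extension `K`" (not dihedral) is implied
  by the tree's `¬ IsQuadraticSelfTwistAE K π` for every quadratic `K/F` (a dihedral
  `π = I_K^F(μ)` satisfies `π ≅ π ⊗ η_{K/F}`, whose unramified shadow `IsQuadraticSelfTwistAE K π`
  is — `LanglandsTetrahedral`).
* "(C) `π'` is not equivalent to `π ⊗ χ` for any idele class character `χ`" is implied by: for
  every Hecke character `χ` of `F` (the tree's `GaloisRepresentations.HeckeCharacter F`: ALL
  continuous quasi-characters of the idele class group, no unitarity or finite order imposed) it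
  is NOT the case that for almost all `v` the Satake parameters satisfy
  `t_{π',v} = χ(ϖ_v) · t_{π,v}` (an isomorphism `π' ≅ π ⊗ χ` gives this relation at every `v`
  unramified for `π`, `π'`, `χ`).
* Conclusion: a CUSPIDAL `Π` on `GL_4(𝔸_F)` (`CuspidalAutomorphicRepData 4 F hF4`) with
  `t_{Π,v} = t_{π,v} ⊗ t_{π',v}` (`satakeTensor`) for almost all `v` — the unramified shadow of
  `(L_v)`; weaker than the printed strong lifting (all `v`, `ε`-factors, `L_∞`), which the tree
  cannot yet express.

So the named fact `Ramakrishnan2000_boxTimes_cuspidal` is: Theorem M (Existence + the "if"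
half of the non-dihedral Cuspidality Criterion) with hypotheses at least as strong and conclusion
weaker than printed. Both hypotheses are needed for the conclusion as stated (cuspidality).

Not here: the existence of `π ⊠ π'` for arbitrary (isobaric, or cuspidal possibly dihedral /
twist-equivalent) pairs as a non-cuspidal isobaric representation; the "only if" halves; the
dihedral case of the criterion (needs base change `π_K` and `I_K^F`); the archimedean identity
`L(s, Π_∞) = L(s, π_∞ × π'_∞)` and the infinity type of `Π` (an archimedean `L`-factor does not
determine the tree's `HasArchParameter` multiset, so no archimedean clause is derived from the
printed statement — consumers needing "`Π` regular algebraic" must cite the archimedean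
functoriality of `⊠` separately); `ε`-factors.

## References

* [Ramakrishnan2000] D. Ramakrishnan, Ann. of Math. 152 (2000) 45–111, Theorem M (§3, p. 9) and
  §2.2 (2.2.6).
* D. Ramakrishnan, S. Wang, Compositio Math. 135 (2003), Thm. 3.2 (arXiv:math/0108054, p. 9) —
  restatement (no bib key; not cited by a declaration).
* [ArthurClozelAMS120] Ch. 3, §2 for `satakeTensor` (`PairLFunctionBaseChange`).
-/

noncomputable section

open scoped NumberField
open NumberField IsDedekindDomain Filter

namespace Literature.NumberTheory.Automorphic

/-! ### Two small lemmas on the tree's `satakeTensor` -/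

/-- Tensoring with a one-element parameter `{c}` multiplies every entry by `c` (a twist).
[cite: ArthurClozelAMS120, Ch. 3, §2] -/
theorem satakeTensor_singleton_left (c : ℂ) (β : Multiset ℂ) :
    satakeTensor {c} β = β.map (c * ·) := by
  rw [← Multiset.cons_zero, satakeTensor_cons_left, satakeTensor_zero_left, add_zero]

/-- The `GL(2) × GL(2)` case: `{a, b} ⊗ {c, d} = {ac, ad, bc, bd}` — the Satake parameter of
`(π ⊠ π')_v` at an unramified place, by (2.2.6). [cite: Ramakrishnan2000, §2.2 (2.2.6)] -/
theorem satakeTensor_pair_pair (a b c d : ℂ) :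
    satakeTensor {a, b} {c, d} = {a * c, a * d, b * c, b * d} := by
  rw [Multiset.insert_eq_cons, satakeTensor_cons_left, satakeTensor_singleton_left]
  simp only [Multiset.insert_eq_cons, Multiset.map_cons, Multiset.map_singleton, Multiset.cons_add,
    Multiset.singleton_add]

/-! ### The named fact -/

/-- **Ramakrishnan 2000, Theorem M (cuspidal case)** (named fact, D-0014): "Let `π, π'` be in
`𝒜(2, F)`. […] There exists an isobaric automorphic representation `π ⊠ π'` of `GL(4, 𝔸_F)`
satisfying (at every finite place `v`) `L(s, (π ⊠ π')_v) = L(s, π_v × π'_v)` […] Suppose `π, π'`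
are both cuspidal. If neither of them is associated to a character of a quadratic extension, then
`π ⊠ π'` is cuspidal iff (C) `π'` is not equivalent to `π ⊗ χ`, for any idele class character `χ`
of `F`." In the tree's language (unramified shadows): for cuspidal `π, π'` on `GL_2(𝔸_F)` such
that (i) neither is an almost-everywhere self-twist by the quadratic character of any quadratic
`K/F` (`¬ IsQuadraticSelfTwistAE`, implying "not associated to a character of a quadratic
extension") and (ii) for NO Hecke character `χ` of `F` do the Satake parameters satisfy
`t_{π',v} = χ(ϖ_v) t_{π,v}` for almost all `v` (implying (C)), there is a CUSPIDAL automorphic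
representation `Π` of `GL_4(𝔸_F)` with `t_{Π,v} = {αᵢβⱼ} = satakeTensor t_{π,v} t_{π',v}` for
almost all finite `v` (the unramified places of `(L_v)`, (2.2.6)).
[cite: Ramakrishnan2000, Theorem M (§3, p. 9) and §2.2 (2.2.6)] -/
def Ramakrishnan2000_boxTimes_cuspidal : Prop :=
  ∀ (F : Type) [Field F] [NumberField F] (hF : isCompact_glFiniteIntegralLevel 2 F)
    (hF4 : isCompact_glFiniteIntegralLevel 4 F) (π π' : CuspidalAutomorphicRepData 2 F hF),
    (∀ (K : Type) [Field K] [NumberField K] [Algebra F K], Module.finrank F K = 2 →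
        ¬ IsQuadraticSelfTwistAE K π.1 ∧ ¬ IsQuadraticSelfTwistAE K π'.1) →
    (∀ χ : GaloisRepresentations.HeckeCharacter F,
        ¬ ∀ᶠ v : HeightOneSpectrum (𝓞 F) in Filter.cofinite, ∀ α β : Multiset ℂ,
            π.1.HasSatakeParamAt v α → π'.1.HasSatakeParamAt v β →
              β = α.map (χ.valueAtUniformizer v * ·)) →
    ∃ P : CuspidalAutomorphicRepData 4 F hF4,
      ∀ᶠ v : HeightOneSpectrum (𝓞 F) in Filter.cofinite, ∀ α β : Multiset ℂ,
        π.1.HasSatakeParamAt v α → π'.1.HasSatakeParamAt v β →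
          P.1.HasSatakeParamAt v (satakeTensor α β)

/-- Unfolding lemma for `Ramakrishnan2000_boxTimes_cuspidal`. [cite: Ramakrishnan2000, Theorem M (§3, p. 9)] -/
theorem Ramakrishnan2000_boxTimes_cuspidal_iff :
    Ramakrishnan2000_boxTimes_cuspidal ↔
      ∀ (F : Type) [Field F] [NumberField F] (hF : isCompact_glFiniteIntegralLevel 2 F)
        (hF4 : isCompact_glFiniteIntegralLevel 4 F) (π π' : CuspidalAutomorphicRepData 2 F hF),
        (∀ (K : Type) [Field K] [NumberField K] [Algebra F K], Module.finrank F K = 2 →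
            ¬ IsQuadraticSelfTwistAE K π.1 ∧ ¬ IsQuadraticSelfTwistAE K π'.1) →
        (∀ χ : GaloisRepresentations.HeckeCharacter F,
            ¬ ∀ᶠ v : HeightOneSpectrum (𝓞 F) in Filter.cofinite, ∀ α β : Multiset ℂ,
                π.1.HasSatakeParamAt v α → π'.1.HasSatakeParamAt v β →
                  β = α.map (χ.valueAtUniformizer v * ·)) →
        ∃ P : CuspidalAutomorphicRepData 4 F hF4,
          ∀ᶠ v : HeightOneSpectrum (𝓞 F) in Filter.cofinite, ∀ α β : Multiset ℂ,
            π.1.HasSatakeParamAt v α → π'.1.HasSatakeParamAt v β →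
              P.1.HasSatakeParamAt v (satakeTensor α β) :=
  Iff.rfl

/-- **Satake parameters of `π ⊠ π'` have four entries** wherever the relation of the fact holds
and `π, π'` are unramified (sanity of the degree: `2 · 2 = 4`). [cite: Ramakrishnan2000, §2.2 (2.2.6)] -/
theorem card_satakeTensor_of_hasSatakeParamAt {F : Type} [Field F] [NumberField F]
    {hF : isCompact_glFiniteIntegralLevel 2 F} {π π' : CuspidalAutomorphicRepData 2 F hF}
    {v : HeightOneSpectrum (𝓞 F)} {α β : Multiset ℂ} (hα : π.1.HasSatakeParamAt v α)
    (hβ : π'.1.HasSatakeParamAt v β) : Multiset.card (satakeTensor α β) = 4 := by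
  rw [card_satakeTensor, hα.card_eq, hβ.card_eq]

end Literature.NumberTheory.Automorphic

end
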